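import Summits.HodgeConjecture.CorCM.Census.OddSliceFacesDescent

/-!
# Faces generate the Hodge lattice of the faithful full odd slice, II: the class functional, the closing face, and the theorem —
# the canonical squares and one closing face generate, for every finite abelian group `A` of odd order

COR-CM (cell `pub-hodgecm2`), count-neutral kernel census by the binder seat b09 (gen 26; lane ODD-SLICE-FACES, part IV of
`OddSliceFacesModel` → `OddSliceFacesSquares` → `OddSliceFacesDescent` → `OddSliceFacesGenerate` → `OddSliceFacesCount` → `OddSliceFacesRecord`; gen 25's
`Census/CyclicPrimeFacesGenerate.lean` with `ℤ/p` replaced by a finite abelian group `A` of odd order and a closing face that exists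
for every such `A`).  Bookkeeping definitions + theorems; no `decide` table, no certificate, no named fact, no geometry, no `sorry`.
HC_CM is not proved anywhere in this cell; nothing here is a headline and nothing here produces a period.

THE THEOREM (`hodge_le_pairs_sup_spanFaces_family`, `hodge_le_pairs_sup_spanFaces_squares`).  `|A| = 2K + 1` odd.  In the
representative-free model of the faithful full slice of `(ℤ/2 × A, (1,0))` (parts I–II) let `family` = the canonical squares (part III:
one face `(rep ω; i, j)` per simple factor `ω` of defect class `≥ 2`) together with ONE closing face `s⋆ = (𝟙_Q; i, j)`, where
`Q ⊂ A` is any set of `K` places and `i ≠ j` are two places outside `Q` (possible iff `|A| ≥ 3`; a choice, `sStar`).  Then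
**`H ≤ P ⊔ ℤ⟨Galois translates of the face classes of family⟩`** for `|A| ≥ 3`, and `H ≤ P ⊔ ℤ⟨translates of the squares⟩` (`= P`,
there being no simple factor other than `E`) for `|A| = 1`.  Part V (`OddSliceFacesCount`) counts the family (`#(simple factors ≠ E)`, b17's `OrbitsA A`)
and part VI transports the statement to b17's sigma-type model of record, where b17's `oddSlice_law` says that no family of fewer vectors
of ANY kind generates.

PROOF (kernel; part III + this file).  (1) KEY LEMMA (part III, `eq_smul_weil_of_wt_le_one`): a Hodge vector supported on the labels
of weight `≤ 1` (`0` and the `δ s`) is a multiple of `weil = Σ_s e_{δ s} − (|A| − 2)·e_0` (the Weil class of `E^{|A|−2} × B₁`).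
(2) THE CLASS FUNCTIONAL `Cfun m = Σ_ψ cwt(ψ)·m(ψ)`, `cwt ψ = wt ψ` if `wt ψ ≤ |A|/2` and `wt ψ − |A|` otherwise: it kills the pairs
(`cwt (ψ+1) = −cwt ψ`, `|A|` odd), changes at most by a sign under Galois translation, VANISHES on every canonical square (signed
corner weights `k, 1 − k, 1 − k, k − 2`), takes the value `|A|` on `weil` (`|A| ≥ 3`) and `|A|` on the class of the closing face
(signed corner weights `K, K, K, K + 2 − |A| = 1 − K`).  (3) By part III every vector is `≡` (mod `P ⊔` squares) to a vector
supported in weight `≤ 1`, which for a Hodge vector is `ρ·weil` by (1); for the closing face class `Cfun` gives `|A| = ρ·|A|`, so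
`ρ = 1` and `weil ∈ P ⊔ ℤ[G]·family`; then every Hodge vector lies there.  For `|A| = 1`, `weil = e_{δ 0} + e_0` IS a pair.
All [folklore].

## References
* [Pohlmann1968] H. Pohlmann, Algebraic cycles on abelian varieties of complex multiplication type, Ann. of Math. 88 (1968), Thm 1.
* [Milne1999] J. S. Milne, Lefschetz motives and the Tate conjecture, Compositio Math. 117 (1999), Prop. 2.1, p. 54.
* [Weil1977HodgeRing] A. Weil, Abelian varieties and the Hodge ring, Œuvres Scientifiques III, [1977c], 421–429.
-/

namespace Summit.HodgeConjecture.CorCM.Census.OddSliceFacesGenerate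

open Finset
open Summit.HodgeConjecture.CorCM.Census.OddSliceFacesModel
open Summit.HodgeConjecture.CorCM.Census.OddSliceFacesSquares
open Summit.HodgeConjecture.CorCM.Census.OddSliceFacesDescent

section Main

variable (A : Type) [AddCommGroup A] [Fintype A] [DecidableEq A]

/-! ## §1 The class functional -/

/-- The signed weight `cwt ψ = wt ψ` for normalised labels, `wt ψ − |A|` otherwise. [folklore] -/
def cwt (ψ : Ty A) : ℤ := if wt A ψ ≤ Fintype.card A / 2 then (wt A ψ : ℤ) else (wt A ψ : ℤ) - Fintype.card A

/-- **The class functional** `Cfun m = Σ_ψ cwt(ψ) m(ψ)`. [folklore] -/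
def Cfun : (Ty A → ℤ) →ₗ[ℤ] ℤ where
  toFun m := cwt A ⬝ᵥ m
  map_add' m m' := dotProduct_add _ _ _
  map_smul' c m := by
    show cwt A ⬝ᵥ (c • m) = c • (cwt A ⬝ᵥ m)
    exact dotProduct_smul c (cwt A) m

omit [AddCommGroup A] in
/-- `Cfun` on a unit vector. [folklore] -/
theorem Cfun_single (ψ : Ty A) (c : ℤ) : Cfun A (Pi.single ψ c) = cwt A ψ * c := by
  show cwt A ⬝ᵥ Pi.single ψ c = cwt A ψ * c
  rw [dotProduct_single]

omit [AddCommGroup A] [DecidableEq A] in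
/-- Signed weight of the conjugate: `cwt (ψ + 1) = −cwt ψ` (`|A|` odd). [folklore] -/
theorem cwt_add_one (hA : Odd (Fintype.card A)) (ψ : Ty A) : cwt A (ψ + 1) = -cwt A ψ := by
  have hodd : Fintype.card A % 2 = 1 := Nat.odd_iff.mp hA
  have hw := wt_le A ψ
  unfold cwt
  rw [wt_add_one]
  by_cases h : wt A ψ ≤ Fintype.card A / 2
  · rw [if_pos h, if_neg (by omega), Nat.cast_sub hw]; ring
  · rw [if_neg h, if_pos (by omega), Nat.cast_sub hw]; ring

omit [DecidableEq A] in
/-- Signed weight is invariant under `(0,t)`-twists. [folklore] -/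
theorem cwt_tw_zero (t : A) (ψ : Ty A) : cwt A (tw A (0, t) ψ) = cwt A ψ := by
  unfold cwt; rw [wt_tw_zero]

omit [DecidableEq A] in
/-- Signed weight of a twist: `± cwt`. [folklore] -/
theorem cwt_tw (hA : Odd (Fintype.card A)) (g : ZMod 2 × A) (ψ : Ty A) :
    cwt A (tw A g ψ) = (if g.1 = 0 then 1 else -1) * cwt A ψ := by
  obtain ⟨a, t⟩ := g
  have h01 : ∀ u : ZMod 2, u = 0 ∨ u = 1 := by decide
  rcases h01 a with rfl | rfl
  · rw [cwt_tw_zero]; simp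
  · rw [tw_one, cwt_add_one A hA, cwt_tw_zero]; simp

omit [AddCommGroup A] in
/-- `Cfun` kills the pairs. [folklore] -/
theorem Cfun_pairVec (hA : Odd (Fintype.card A)) (ψ : Ty A) : Cfun A (pairVec A ψ) = 0 := by
  unfold pairVec
  rw [map_add, Cfun_single, Cfun_single, cwt_add_one A hA]
  ring

/-- `Cfun` changes at most by a sign under Galois translation. [folklore] -/
theorem Cfun_transl (hA : Odd (Fintype.card A)) (g : ZMod 2 × A) (v : Ty A → ℤ) :
    Cfun A (transl A g v) = (if g.1 = 0 then 1 else -1) * Cfun A v := by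
  show cwt A ⬝ᵥ transl A g v = (if g.1 = 0 then 1 else -1) * (cwt A ⬝ᵥ v)
  rw [transl_eq_comp, dotProduct_comp_equiv_symm]
  have hc : (cwt A ∘ (twEquiv A g)) = (if g.1 = 0 then (1 : ℤ) else -1) • cwt A := by
    funext ψ
    show cwt A (tw A g ψ) = ((if g.1 = 0 then (1 : ℤ) else -1) • cwt A) ψ
    rw [Pi.smul_apply, smul_eq_mul, cwt_tw A hA]
  rw [hc, smul_dotProduct, smul_eq_mul]

omit [AddCommGroup A] in
/-- `Cfun` of a face class, corner by corner. [folklore] -/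
theorem Cfun_faceVec (φ : Ty A) (i j : A) :
    Cfun A (faceVec A φ i j) = cwt A φ + cwt A (φ + 1 + δ A i) + cwt A (φ + 1 + δ A j) + cwt A (φ + δ A i + δ A j) := by
  unfold faceVec
  rw [map_add, map_add, map_add, Cfun_single, Cfun_single, Cfun_single, Cfun_single]
  ring

omit [AddCommGroup A] in
/-- **`Cfun` vanishes on the class of every face through two defects of a normalised type of weight `≥ 2`** (signed corner
weights `k, 1 − k, 1 − k, k − 2`). [folklore] -/
theorem Cfun_faceVec_eq_zero (hA : Odd (Fintype.card A)) {φ : Ty A} {i j : A} (hi : φ i = 1) (hj : φ j = 1) (hij : i ≠ j)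
    (hφ : wt A φ ≤ Fintype.card A / 2) : Cfun A (faceVec A φ i j) = 0 := by
  have hodd : Fintype.card A % 2 = 1 := Nat.odd_iff.mp hA
  have hw := wt_le A φ
  have h2φ : 2 ≤ wt A φ := by
    unfold wt
    exact Finset.one_lt_card_iff.mpr ⟨i, j, by simp [hi], by simp [hj], hij⟩
  rw [Cfun_faceVec]
  unfold cwt
  have c1 : ¬ (Fintype.card A - wt A φ + 1 ≤ Fintype.card A / 2) := by omega
  have c2 : wt A φ - 2 ≤ Fintype.card A / 2 := by omega
  rw [wt_corner_bar A hi, wt_corner_bar A hj, wt_corner_flip A hi hj hij, if_pos hφ, if_neg c1, if_pos c2]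
  have e1 : ((Fintype.card A - wt A φ + 1 : ℕ) : ℤ) = (Fintype.card A : ℤ) - (wt A φ : ℤ) + 1 := by
    rw [Nat.cast_add, Nat.cast_sub hw]; simp
  have e2 : ((wt A φ - 2 : ℕ) : ℤ) = (wt A φ : ℤ) - 2 := by rw [Nat.cast_sub h2φ]; simp
  rw [e1, e2]
  ring

/-- `Cfun` vanishes on `P ⊔ spanFaces squares`. [folklore] -/
theorem Cfun_eq_zero_of_mem (hA : Odd (Fintype.card A)) {v : Ty A → ℤ} (hv : v ∈ pairs A ⊔ spanFaces A (squares A)) :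
    Cfun A v = 0 := by
  have hle : pairs A ⊔ spanFaces A (squares A) ≤ LinearMap.ker (Cfun A) := by
    refine sup_le (Submodule.span_le.mpr ?_) (Submodule.span_le.mpr ?_)
    · rintro _ ⟨ψ, rfl⟩
      exact Cfun_pairVec A hA ψ
    · rintro _ ⟨g, f, hf, rfl⟩
      obtain ⟨ω, hω, rfl⟩ := Finset.mem_image.mp hf
      have h2 : 2 ≤ wt A (rep A ω) := by rw [wt_rep]; exact (Finset.mem_filter.mp hω).2
      obtain ⟨hij, hi, hj⟩ := pick_spec A h2
      show Cfun A (transl A g (faceVec A (rep A ω) (pick A (rep A ω)).1 (pick A (rep A ω)).2)) = 0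
      rw [Cfun_transl A hA, Cfun_faceVec_eq_zero A hA hi hj hij (by rw [wt_rep]; exact (one_le_cls A ω).2), mul_zero]
  exact hle hv

omit [AddCommGroup A] in
/-- **`Cfun weil = |A|`** (`|A| ≥ 2`). [folklore] -/
theorem Cfun_weil (h2 : 2 ≤ Fintype.card A) : Cfun A (weil A) = Fintype.card A := by
  have h1 : 1 ≤ Fintype.card A / 2 := by omega
  unfold weil
  rw [map_sub, map_sum, map_smul, Cfun_single, smul_eq_mul]
  simp_rw [Cfun_single]
  unfold cwt
  simp_rw [wt_delta, wt_zero]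
  rw [if_pos h1, if_pos (Nat.zero_le _)]
  simp [Finset.sum_const, Finset.card_univ]

/-! ## §2 The closing face -/

omit [AddCommGroup A] in
/-- Data of a closing face: a set `Q` of `⌊|A|/2⌋` places and two distinct places outside it — they exist iff `|A| ≥ 3` (for `|A|`
odd). [folklore] -/
theorem exists_closing (h3 : 3 ≤ Fintype.card A) :
    ∃ Q : Finset A, ∃ i j : A, Q.card = Fintype.card A / 2 ∧ i ∉ Q ∧ j ∉ Q ∧ i ≠ j := by
  obtain ⟨i, j, hij⟩ := Fintype.exists_pair_of_one_lt_card (by omega : 1 < Fintype.card A)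
  have hc : Fintype.card A / 2 ≤ (univ \ {i, j} : Finset A).card := by
    rw [Finset.card_univ_sdiff, Finset.card_pair hij]
    omega
  obtain ⟨Q, hQ, hQc⟩ := Finset.exists_subset_card_eq hc
  refine ⟨Q, i, j, hQc, fun h => ?_, fun h => ?_, hij⟩
  · have := hQ h; simp at this
  · have := hQ h; simp at this

/-- **The closing face** `s⋆ = (𝟙_Q; i, j)`: `|Q| = K = ⌊|A|/2⌋`, `i ≠ j ∉ Q`; its corners `𝟙_Q, 𝟙_{Qᶜ∖i}, 𝟙_{Qᶜ∖j}, 𝟙_{Q ∪ {i,j}}` have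
weights `K, K, K, K + 2` (a choice of such data; the junk face `(0; 0, 0)` when `|A| < 3`). [folklore] -/
noncomputable def sStar : Ty A × A × A :=
  if h : 3 ≤ Fintype.card A then
    (ind A (exists_closing A h).choose, (exists_closing A h).choose_spec.choose,
      (exists_closing A h).choose_spec.choose_spec.choose)
  else (0, 0, 0)

/-- The data of the closing face. [folklore] -/
theorem sStar_spec (h3 : 3 ≤ Fintype.card A) : ∃ Q : Finset A, ∃ i j : A,
    sStar A = (ind A Q, i, j) ∧ Q.card = Fintype.card A / 2 ∧ i ∉ Q ∧ j ∉ Q ∧ i ≠ j := by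
  unfold sStar
  rw [dif_pos h3]
  exact ⟨_, _, _, rfl, (exists_closing A h3).choose_spec.choose_spec.choose_spec⟩

/-- The canonical squares and the closing face. [folklore] -/
noncomputable def family : Finset (Ty A × A × A) := squares A ∪ {sStar A}

/-- The two places of the closing face are distinct. [folklore] -/
theorem sStar_places (h3 : 3 ≤ Fintype.card A) : (sStar A).2.1 ≠ (sStar A).2.2 := by
  obtain ⟨Q, i, j, hs, -, -, -, hij⟩ := sStar_spec A h3
  rw [hs]; exact hij

/-- The first place of the closing face is not a defect of its type. [folklore] -/
theorem sStar_fst_apply (h3 : 3 ≤ Fintype.card A) : (sStar A).1 (sStar A).2.1 = 0 := by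
  obtain ⟨Q, i, j, hs, -, hi, -, -⟩ := sStar_spec A h3
  rw [hs]
  simp only [ind, if_neg hi]

/-- **`Cfun` of the closing face class is `|A|`** (signed corner weights `K, K, K, K + 2 − |A|`, `|A| = 2K + 1`). [folklore] -/
theorem Cfun_sStar (hA : Odd (Fintype.card A)) (h3 : 3 ≤ Fintype.card A) :
    Cfun A (faceVec A (sStar A).1 (sStar A).2.1 (sStar A).2.2) = Fintype.card A := by
  have hodd : Fintype.card A % 2 = 1 := Nat.odd_iff.mp hA
  obtain ⟨Q, i, j, hs, hQ, hi, hj, hij⟩ := sStar_spec A h3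
  have hji : j ∉ insert i Q := by
    rw [Finset.mem_insert]; exact fun h => h.elim (fun h' => hij h'.symm) hj
  rw [hs]
  show Cfun A (faceVec A (ind A Q) i j) = Fintype.card A
  rw [Cfun_faceVec]
  -- the four corners as indicator types
  have c2 : ind A Q + 1 + δ A i = ind A (insert i Q) + 1 := by
    rw [add_right_comm, ind_add_delta_of_not_mem A hi]
  have c3 : ind A Q + 1 + δ A j = ind A (insert j Q) + 1 := by
    rw [add_right_comm, ind_add_delta_of_not_mem A hj]
  have c4 : ind A Q + δ A i + δ A j = ind A (insert j (insert i Q)) := by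
    rw [ind_add_delta_of_not_mem A hi, ind_add_delta_of_not_mem A hji]
  rw [c2, c3, c4]
  unfold cwt
  rw [wt_add_one, wt_add_one, wt_ind, wt_ind, wt_ind, wt_ind, Finset.card_insert_of_notMem hi,
    Finset.card_insert_of_notMem hj, Finset.card_insert_of_notMem hji, Finset.card_insert_of_notMem hi, hQ]
  have d1 : Fintype.card A / 2 ≤ Fintype.card A / 2 := le_rfl
  have d2 : Fintype.card A - (Fintype.card A / 2 + 1) ≤ Fintype.card A / 2 := by omega
  have d3 : ¬ (Fintype.card A / 2 + 1 + 1 ≤ Fintype.card A / 2) := by omega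
  rw [if_pos d1, if_pos d2, if_neg d3]
  have e2 : ((Fintype.card A - (Fintype.card A / 2 + 1) : ℕ) : ℤ) = (Fintype.card A : ℤ) - ((Fintype.card A / 2 : ℕ) : ℤ) - 1 := by
    rw [Nat.cast_sub (by omega)]; push_cast; ring
  rw [e2]
  have hn : (Fintype.card A : ℤ) = 2 * ((Fintype.card A / 2 : ℕ) : ℤ) + 1 := by
    have h2 : Fintype.card A = 2 * (Fintype.card A / 2) + 1 := by omega
    exact_mod_cast h2
  rw [hn]
  push_cast
  ring

/-! ## §3 The theorem -/

/-- All faces of the family have distinct places (`|A| ≥ 3`). [folklore] -/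
theorem family_places (h3 : 3 ≤ Fintype.card A) {f : Ty A × A × A} (hf : f ∈ family A) : f.2.1 ≠ f.2.2 := by
  rcases Finset.mem_union.mp hf with h | h
  · exact squares_places A h
  · rw [Finset.mem_singleton] at h; rw [h]; exact sStar_places A h3

/-- **The Weil vector lies in `P ⊔ ℤ[G]·family`** (`|A|` odd, `≥ 3`). [folklore] -/
theorem weil_mem (hA : Odd (Fintype.card A)) (h3 : 3 ≤ Fintype.card A) : weil A ∈ pairs A ⊔ spanFaces A (family A) := by
  set mstar := faceVec A (sStar A).1 (sStar A).2.1 (sStar A).2.2 with hm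
  have hmH : mstar ∈ hodge A := faceVec_mem A _ (sStar_places A h3)
  obtain ⟨r, hr, hdiff⟩ := exists_reduced A hA mstar
  have hsub : pairs A ⊔ spanFaces A (squares A) ≤ hodge A :=
    sup_le (pairs_le_hodge A) (spanFaces_le_hodge A fun f hf => squares_places A hf)
  have hrH : r ∈ hodge A := by
    have : r = mstar - (mstar - r) := by abel
    rw [this]; exact Submodule.sub_mem _ hmH (hsub hdiff)
  have hreq := eq_smul_weil_of_wt_le_one A r hrH hr
  -- apply the class functional
  have hC : Cfun A mstar - Cfun A r = 0 := by rw [← map_sub]; exact Cfun_eq_zero_of_mem A hA hdiff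
  rw [hm, Cfun_sStar A hA h3, hreq, map_smul, Cfun_weil A (by omega), smul_eq_mul] at hC
  have hρ : r (δ A 0) = 1 := by
    have hn0 : (Fintype.card A : ℤ) ≠ 0 := by exact_mod_cast (show Fintype.card A ≠ 0 by omega)
    have : (1 - r (δ A 0)) * (Fintype.card A : ℤ) = 0 := by linarith
    rcases mul_eq_zero.mp this with h | h
    · linarith
    · exact absurd h hn0
  rw [hρ, one_smul] at hreq
  -- `weil = mstar − (mstar − r)`
  have hw : weil A = mstar - (mstar - r) := by rw [hreq]; abel
  rw [hw]
  refine Submodule.sub_mem _ ?_ ?_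
  · refine Submodule.mem_sup_right (Submodule.subset_span ⟨0, sStar A, ?_, ?_⟩)
    · exact Finset.mem_union_right _ (Finset.mem_singleton_self _)
    · rw [hm, transl_zero]
  · exact (sup_le_sup_left (spanFaces_mono A Finset.subset_union_left) _) hdiff

/-- **THE THEOREM.**  For every finite abelian group `A` of odd order `≥ 3`, the Hodge lattice of the faithful full slice of
`(ℤ/2 × A, (1,0))` is generated, together with the divisor classes, by the Galois translates of the classes of the rank-four faces
of `family` (the canonical squares and the closing face). [folklore] -/
theorem hodge_le_pairs_sup_spanFaces_family (hA : Odd (Fintype.card A)) (h3 : 3 ≤ Fintype.card A) :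
    hodge A ≤ pairs A ⊔ spanFaces A (family A) := by
  intro m hm
  obtain ⟨r, hr, hdiff⟩ := exists_reduced A hA m
  have hsub : pairs A ⊔ spanFaces A (squares A) ≤ hodge A :=
    sup_le (pairs_le_hodge A) (spanFaces_le_hodge A fun f hf => squares_places A hf)
  have hrH : r ∈ hodge A := by
    have : r = m - (m - r) := by abel
    rw [this]; exact Submodule.sub_mem _ hm (hsub hdiff)
  have hreq := eq_smul_weil_of_wt_le_one A r hrH hr
  have : m = (m - r) + r := by abel
  rw [this]
  refine Submodule.add_mem _ ((sup_le_sup_left (spanFaces_mono A Finset.subset_union_left) _) hdiff) ?_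
  rw [hreq]
  exact Submodule.smul_mem _ _ (weil_mem A hA h3)

/-- For `|A| = 1` (the slice of an imaginary quadratic field: `E` alone) the Weil vector `e_{δ 0} + e_0` is the pair through `0`.
[folklore] -/
theorem weil_mem_pairs (h1 : Fintype.card A = 1) : weil A ∈ pairs A := by
  have hsub : Subsingleton A := Fintype.card_le_one_iff_subsingleton.mp h1.le
  have hδ : δ A 0 = (0 : Ty A) + 1 := by
    funext s
    rw [Subsingleton.elim s 0, delta_apply, if_pos rfl]
    simp
  have huniv : (univ : Finset A) = {0} := Finset.eq_singleton_iff_unique_mem.mpr ⟨Finset.mem_univ _, fun s _ => Subsingleton.elim s 0⟩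
  have hw : weil A = pairVec A 0 := by
    unfold weil pairVec
    rw [huniv, Finset.sum_singleton, h1, hδ]
    have e : (((1 : ℕ) : ℤ) - 2) = -1 := by norm_num
    rw [e, neg_one_smul, sub_neg_eq_add, add_comm]
  rw [hw]
  exact Submodule.subset_span ⟨0, rfl⟩

/-- **The case `|A| = 1`**: the Hodge lattice is generated by the pairs and the (empty set of) canonical squares. [folklore] -/
theorem hodge_le_pairs_sup_spanFaces_squares (hA : Odd (Fintype.card A)) (h1 : Fintype.card A = 1) :
    hodge A ≤ pairs A ⊔ spanFaces A (squares A) := by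
  intro m hm
  obtain ⟨r, hr, hdiff⟩ := exists_reduced A hA m
  have hsub : pairs A ⊔ spanFaces A (squares A) ≤ hodge A :=
    sup_le (pairs_le_hodge A) (spanFaces_le_hodge A fun f hf => squares_places A hf)
  have hrH : r ∈ hodge A := by
    have : r = m - (m - r) := by abel
    rw [this]; exact Submodule.sub_mem _ hm (hsub hdiff)
  have hreq := eq_smul_weil_of_wt_le_one A r hrH hr
  have : m = (m - r) + r := by abel
  rw [this]
  refine Submodule.add_mem _ hdiff ?_
  rw [hreq]
  exact Submodule.mem_sup_left (Submodule.smul_mem _ _ (weil_mem_pairs A h1))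

end Main

end Summit.HodgeConjecture.CorCM.Census.OddSliceFacesGenerate
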